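/- Width seat 2/3 `ym-line-cbag-p1-w2` (prover-ym-line-cbag-p1-w2-g20-0) of the cell of ideator ym-idea-2, LINE 8
(route `EguchiKawaiDirectionLadder`), post-closure glue for the barrier entry `EguchiKawaiBreakdown`: in the `U(N)` single-site
model EVERY OPEN Wilson word (non-zero winding in some direction) averages to ZERO at every finite `N` and every coupling — the
`U(1)^d` symmetry (14.41) is exact; only `⟨|W_l|²⟩` can signal the breakdown.  Generalises the barrier file's
`ekExpectation_openLine_re/im` (one letter, flip `Z_μ = −1`) to all open words (phase `Z_μ = e^{iπ/q_μ}`).  Route-independent;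
YM mass gap NOT touched (barrier-ledger line). -/
import Summits.QuantumFields.YangMills.Theorems.EguchiKawaiDirectionLadderWilsonWordClosed
import HarnessLib

/-!
# Open Wilson words of the `U(N)` Eguchi–Kawai model average to zero at every finite `N`

For a word `W_l = (1/N) tr U_{μ₁}^{ε₁} ⋯ U_{μ_k}^{ε_k}` with winding `q = q_μ(l) ≠ 0` in the direction `μ`, the centre
transformation `U_μ ↦ e^{iπ/q} U_μ` (14.41) preserves `∏ dU_ν` and the weight `e^{−N² b S_R}` and multiplies `W_l` by
`(e^{iπ/q})^q = e^{iπ} = −1` (14.48); hence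

* `integral_ekWord_mul_ekWeight_eq_zero` : `∫ ∏ dU_ν e^{−N² b S_R} W_l = 0`,
* `ekExpectation_openWord_re / _im` : `⟨Re W_l⟩_EK = ⟨Im W_l⟩_EK = 0` for every `d`, `N`, `b`.

Together with `ekOpenWordsVanish_of_strongCoupling` (`⟨|W_l|²⟩_EK → 0` at strong coupling) and the breakdown
`EguchiKawaiBreakdown_holds` (`⟨|W_{[(μ,+)]}|²⟩_EK ↛ 0` at weak coupling, `d ≥ 3`) this is the complete finite-`N` / large-`N` picture
of the open words that Makeenko §14.3 describes in words («This symmetry is global and can be broken spontaneously as `N → ∞`»).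

HONEST FRAMING.  Exact-symmetry bookkeeping for the single-site integral; nothing about the reduction, the loop equations or the
Yang–Mills mass gap / the summit `YangMills` is proved or advanced.

References: Y. Makeenko, *Methods of Contemporary Gauge Theory* (2023) §14.3 (14.41), (14.48) (PDF pp. 245–246).
-/

set_option autoImplicit false

noncomputable section

open scoped Matrix ComplexConjugate BigOperators Real
open Matrix Complex Finset MeasureTheory Filter Topology
open Literature.Barriers.QuantumFields (UN EKConfig ekHaar ekWeight ekExpectation isPhaseInvariant_ekWeight continuous_ekWeight)

namespace Summit.QuantumFields.YangMills.Theorems.EguchiKawaiDirectionLadder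

variable {d N : ℕ}

/-- A unit complex number times the identity is a unitary matrix (the centre `U(1) ⊂ U(N)`, (14.41)). -/
theorem smul_one_mem_unitaryGroup {c : ℂ} (hc : ‖c‖ = 1) :
    c • (1 : Matrix (Fin N) (Fin N) ℂ) ∈ Matrix.unitaryGroup (Fin N) ℂ := by
  rw [Matrix.mem_unitaryGroup_iff]
  have h : c * conj c = 1 := by
    rw [Complex.mul_conj, ← Complex.sq_norm, hc, one_pow, Complex.ofReal_one]
  rw [star_eq_conjTranspose, conjTranspose_smul, conjTranspose_one, smul_mul_smul_comm, Matrix.one_mul, star_def, h,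
    one_smul]

/-- The phase `e^{iπ/q}` has modulus one. -/
theorem norm_exp_pi_div_mul_I (q : ℤ) : ‖Complex.exp ((π / q : ℝ) * I)‖ = 1 :=
  Complex.norm_exp_ofReal_mul_I _

/-- `(e^{iπ/q})^q = −1` for `q ≠ 0`. -/
theorem exp_pi_div_mul_I_zpow {q : ℤ} (hq : q ≠ 0) : Complex.exp ((π / q : ℝ) * I) ^ q = -1 := by
  rw [← Complex.exp_int_mul, ← Complex.exp_pi_mul_I]
  congr 1
  have hq' : (q : ℂ) ≠ 0 := by exact_mod_cast hq
  push_cast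
  field_simp

/-- The word times the weight is integrable on `U(N)^d` (continuous on a compact space). -/
theorem integrable_ekWord_mul_ekWeight (b : ℝ) (l : List (Fin d × Bool)) :
    Integrable (fun U : EKConfig d N => ekWord l U * (ekWeight N b U : ℂ)) (ekHaar d N) := by
  have hc : Continuous fun U : EKConfig d N => ekWord l U * (ekWeight N b U : ℂ) :=
    (continuous_ekWord l).mul (Complex.continuous_ofReal.comp (continuous_ekWeight N b))
  unfold ekHaar
  exact hc.integrable_of_hasCompactSupport (HasCompactSupport.of_compactSpace _)

/-- **Exact `U(1)^d` symmetry of the `U(N)` single-site model: every open word integrates to zero**, at every `N`, every `b`: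
if `q_μ(l) ≠ 0` then `∫ ∏ dU_ν e^{−N² b S_R} W_l = 0` — rotate `U_μ ↦ e^{iπ/q_μ} U_μ`; measure and weight are invariant and the
word changes sign ((14.48): it picks up `(e^{iπ/q_μ})^{q_μ} = −1`). -/
theorem integral_ekWord_mul_ekWeight_eq_zero (b : ℝ) {l : List (Fin d × Bool)} {μ : Fin d} (hq : wordCharge l μ ≠ 0) :
    ∫ U, ekWord l U * (ekWeight N b U : ℂ) ∂ekHaar d N = 0 := by
  -- the phase and the central element
  set c : ℂ := Complex.exp ((π / (wordCharge l μ) : ℝ) * I) with hcdef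
  have hc : ‖c‖ = 1 := norm_exp_pi_div_mul_I _
  have hcq : c ^ wordCharge l μ = -1 := exp_pi_div_mul_I_zpow hq
  set z : UN N := ⟨c • (1 : Matrix (Fin N) (Fin N) ℂ), smul_one_mem_unitaryGroup hc⟩ with hzdef
  -- the rotation of the link `μ` as a group element of `U(N)^d` acting on the left, and as a measurable equivalence
  set g : EKConfig d N := fun i => if i = μ then z else 1 with hgdef
  have hmp : MeasurePreserving (fun U : EKConfig d N => g * U) (ekHaar d N) (ekHaar d N) := by
    have e : (fun U : EKConfig d N => g * U) = fun U i => g i * U i := by funext U i; rfl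
    rw [e]
    unfold ekHaar
    exact measurePreserving_pi _ _ (fun i => measurePreserving_mul_left _ _)
  have hmp' : MeasurePreserving (fun U : EKConfig d N => g⁻¹ * U) (ekHaar d N) (ekHaar d N) := by
    have e : (fun U : EKConfig d N => g⁻¹ * U) = fun U i => g⁻¹ i * U i := by funext U i; rfl
    rw [e]
    unfold ekHaar
    exact measurePreserving_pi _ _ (fun i => measurePreserving_mul_left _ _)
  let eqv : EKConfig d N ≃ᵐ EKConfig d N :=
    { toFun := fun U => g * U
      invFun := fun U => g⁻¹ * U
      left_inv := fun U => by simp [← mul_assoc]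
      right_inv := fun U => by simp [← mul_assoc]
      measurable_toFun := hmp.measurable
      measurable_invFun := hmp'.measurable }
  have hmpe : MeasurePreserving eqv (ekHaar d N) (ekHaar d N) := hmp
  -- linkwise the rotated configuration is a unit phase times the original
  have hphase : ∀ (U : EKConfig d N) (ν : Fin d),
      (((g * U) ν : UN N) : Matrix (Fin N) (Fin N) ℂ) =
        (if ν = μ then c else 1) • ((U ν : UN N) : Matrix (Fin N) (Fin N) ℂ) := by
    intro U ν
    rw [Pi.mul_apply, Submonoid.coe_mul]
    by_cases h : ν = μ
    · subst h
      simp only [hgdef, if_true, hzdef, smul_mul_assoc, Matrix.one_mul]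
    · simp only [hgdef, if_neg h, OneMemClass.coe_one, Matrix.one_mul, one_smul]
  have hphase' : ∀ (U : EKConfig d N) (ν : Fin d), ∃ c' : ℂ, ‖c'‖ = 1 ∧
      (((g * U) ν : UN N) : Matrix (Fin N) (Fin N) ℂ) = c' • ((U ν : UN N) : Matrix (Fin N) (Fin N) ℂ) := by
    intro U ν
    refine ⟨if ν = μ then c else 1, ?_, hphase U ν⟩
    split_ifs
    · exact hc
    · exact norm_one
  -- the word picks up `c ^ q_μ = -1`, the weight is invariant
  have hword : ∀ U : EKConfig d N, ekWord l (g * U) = -ekWord l U := by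
    intro U
    have h1 := ekWordMatrix_phase (U := U) (U' := g * U) (c := fun ν => if ν = μ then c else 1) (hphase U) l
    have hcs : ∀ ν : Fin d, ‖(if ν = μ then c else (1 : ℂ))‖ = 1 := fun ν => by
      split_ifs
      · exact hc
      · exact norm_one
    have h2 := phaseProd_eq_prod_zpow (c := fun ν => if ν = μ then c else 1) hcs l
    have h3 : ∏ ν : Fin d, (if ν = μ then c else (1 : ℂ)) ^ wordCharge l ν = c ^ wordCharge l μ := by
      have : ∀ ν : Fin d, (if ν = μ then c else (1 : ℂ)) ^ wordCharge l ν = if ν = μ then c ^ wordCharge l μ else 1 := by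
        intro ν
        split_ifs with h
        · rw [h]
        · exact one_zpow _
      rw [Finset.prod_congr rfl fun ν _ => this ν, Finset.prod_ite_eq']
      simp
    rw [ekWord, ekWord, h1, h2, h3, hcq, trace_smul, smul_eq_mul, neg_one_mul, neg_div]
  have hweight : ∀ U : EKConfig d N, ekWeight N b (g * U) = ekWeight N b U := fun U =>
    isPhaseInvariant_ekWeight N b U (g * U) (hphase' U)
  -- the integral equals minus itself
  set J := ∫ U, ekWord l U * (ekWeight N b U : ℂ) ∂ekHaar d N with hJ
  have key : J = -J := by
    calc J = ∫ U, ekWord l (g * U) * (ekWeight N b (g * U) : ℂ) ∂ekHaar d N := by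
          rw [hJ, ← hmpe.integral_comp']
          rfl
      _ = -J := by
          rw [hJ, ← integral_neg]
          refine integral_congr_ae (Eventually.of_forall fun U => ?_)
          simp only [hword, hweight, neg_mul]
  have h2 : (2 : ℂ) * J = 0 := by rw [two_mul]; nth_rewrite 2 [key]; ring
  rcases mul_eq_zero.1 h2 with h | h
  · norm_num at h
  · exact h

/-- **`⟨Re W_l⟩_EK = 0` for every open word, at every finite `N` and every coupling** (exact `U(1)^d` symmetry of the `U(N)`
single-site model; Makeenko p. 246: the symmetry «can be broken spontaneously» only «as `N → ∞`»). -/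
theorem ekExpectation_openWord_re (b : ℝ) {l : List (Fin d × Bool)} {μ : Fin d} (hq : wordCharge l μ ≠ 0) :
    ekExpectation N b (fun U : EKConfig d N => (ekWord l U).re) = 0 := by
  unfold ekExpectation
  have h2 := Complex.reCLM.integral_comp_comm (integrable_ekWord_mul_ekWeight (d := d) (N := N) b l)
  simp only [Complex.reCLM_apply, Complex.re_mul_ofReal] at h2
  rw [integral_ekWord_mul_ekWeight_eq_zero b hq, Complex.zero_re] at h2
  show (∫ U, (ekWord l U).re * ekWeight N b U ∂ekHaar d N) / _ = 0
  rw [h2, zero_div]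

/-- **`⟨Im W_l⟩_EK = 0` for every open word, at every finite `N` and every coupling.** -/
theorem ekExpectation_openWord_im (b : ℝ) {l : List (Fin d × Bool)} {μ : Fin d} (hq : wordCharge l μ ≠ 0) :
    ekExpectation N b (fun U : EKConfig d N => (ekWord l U).im) = 0 := by
  unfold ekExpectation
  have h2 := Complex.imCLM.integral_comp_comm (integrable_ekWord_mul_ekWeight (d := d) (N := N) b l)
  simp only [Complex.imCLM_apply, Complex.im_mul_ofReal] at h2
  rw [integral_ekWord_mul_ekWeight_eq_zero b hq, Complex.zero_im] at h2
  show (∫ U, (ekWord l U).im * ekWeight N b U ∂ekHaar d N) / _ = 0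
  rw [h2, zero_div]

end Summit.QuantumFields.YangMills.Theorems.EguchiKawaiDirectionLadder
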